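import Summits.CriticalPhenomena.PercolationContinuityZ3.Theorems.PercNearOneGluingNoHeavyPcintBSMRFast3S
import HarnessLib

/-!
# PCINT lane, PHASE 11 (reach-4 pieces), SITE version: splitting the bit-mask site functional over the outer piece list

Cell `prim-pcint`, seat `prim-pcint-1` (gen 18); memo `run/shared/lean/prim/pcint/T-FIBRE-ROUTE.md` §PHASE 11.
With 337 reach-4 pieces one `decide +kernel` of `BSMR.certFastMS` at a small offset exceeds the kernel's memory guard
(113 569 pair terms).  **`BSMR.certFastMS2 RO RI`** is the same functional with separate outer (`RO`) and inner (`RI`) piece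
lists; `certFastMS RS = certFastMS2 RS RS` (**`BSMR.certFastMS_eq_two`**) and the outer list splits additively
(**`BSMR.certFastMS2_append`**, **`BSMR.certFastMS2_outer_split`**), so an instance bounds the parts separately and adds.
-/

namespace Summit.CriticalPhenomena.PercolationContinuityZ3.Theorems.Pcint.BSMR

/-- The bit-mask site functional with separate outer and inner piece-record lists. -/
def certFastMS2 (RO RI : List (ℕ × (ℤ × ℤ) × List ℕ)) (k A B E : ℕ) (V0t V1t : ℤ × ℤ → ℕ) (y : ℤ × ℤ) (sh : ℕ) : ℕ :=
  let RQ := RI.map fun Q => (Q.1, Q.2.1, Nat.shiftLeft (maskOf Q.2.2) sh)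
  (RO.map fun P =>
    let bP := P.2.2.map (· + 312)
    let MP := maskOf bP
    (RQ.map fun Q => termMS k A B E V0t V1t y MP bP P Q).sum).sum

/-- `certFastMS` is the two-list functional on the diagonal. -/
theorem certFastMS_eq_two (RS : List (ℕ × (ℤ × ℤ) × List ℕ)) (k A B E : ℕ) (V0t V1t : ℤ × ℤ → ℕ) (y : ℤ × ℤ)
    (sh : ℕ) : certFastMS RS k A B E V0t V1t y sh = certFastMS2 RS RS k A B E V0t V1t y sh := rfl

/-- The two-list functional is additive in the outer list. -/
theorem certFastMS2_append (R₁ R₂ RI : List (ℕ × (ℤ × ℤ) × List ℕ)) (k A B E : ℕ) (V0t V1t : ℤ × ℤ → ℕ) (y : ℤ × ℤ)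
    (sh : ℕ) : certFastMS2 (R₁ ++ R₂) RI k A B E V0t V1t y sh =
      certFastMS2 R₁ RI k A B E V0t V1t y sh + certFastMS2 R₂ RI k A B E V0t V1t y sh := by
  unfold certFastMS2
  simp only [List.map_append, List.sum_append]

/-- **Outer split**: the functional over `RO` is the part over `RO.take a` plus the part over `RO.drop a`. -/
theorem certFastMS2_outer_split (RO RI : List (ℕ × (ℤ × ℤ) × List ℕ)) (a : ℕ) (k A B E : ℕ) (V0t V1t : ℤ × ℤ → ℕ)
    (y : ℤ × ℤ) (sh : ℕ) : certFastMS2 RO RI k A B E V0t V1t y sh =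
      certFastMS2 (RO.take a) RI k A B E V0t V1t y sh + certFastMS2 (RO.drop a) RI k A B E V0t V1t y sh := by
  rw [← certFastMS2_append, List.take_append_drop]

end Summit.CriticalPhenomena.PercolationContinuityZ3.Theorems.Pcint.BSMR
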